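import Summits.ValiantsHypothesis.ValiantsHypothesis.Theorems.LacunarySymmetroidMatrixDescartesCensusTropicalKLawStatic
import Summits.ValiantsHypothesis.ValiantsHypothesis.Theorems.LacunarySymmetroidMatrixDescartesCensusTropicalKLawSlopes
import Summits.ValiantsHypothesis.ValiantsHypothesis.Theorems.KPlusLogSqLawTropicalBChangedSetExclusivity

/-!
# Route «KPlusLogSqLaw», crux `TropicalB` (stmt-ValiantsHypothesis-19771) — THE COSET-SKELETON LAW:
# «global factor multiplies, local factor adds» — chains whose permutations are `g ∘ τ` with `g` from a set `G` and `τ`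
# block-local have at most `|G| · (1 + Σ_blocks (multichoose K |B| − 1))` terms

HONEST FRAMING.  Helper toward the registered stubs `stub_tropThin` / `stub_tropFat` of `Cruxes/TropicalB/Lines/birth.lean`
(crux `Summit.ValiantsHypothesis.ValiantsHypothesis.Theses.KPlusLogSqLaw.TropicalB`, item stmt-ValiantsHypothesis-19771, route
KPlusLogSqLaw; cell `pub-symmetroid`, seat val-sym-trop-p4 g9, 2026-08-27; `--supports … --as helper`).  A NO-GO ROW OF THE REGISTER
CENSUS (architecture sector, companion of `…TropicalBBalancedSkeleton` / `…TropicalBAffineSkeleton`); nothing here bounds `TropicalB`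
for general designs, and nothing bears on `WeakLifting`, DoorA26 / DoorA34, `MatrixDescartes` (stmt-ValiantsHypothesis-18050) or VP ≠ VNP.

SETTING.  Columns are partitioned into blocks by `blk : Fin m → Fin s`.  A permutation `ρ` is BLOCK-LOCAL when `blk (ρ b) = blk b`
for all `b`.  The chain's permutations are assumed to factor as `σ_k = g ∘ τ` with `g ∈ G` (any finite set of «global» permutations)
and `τ` block-local — equivalently `g⁻¹ ∘ σ_k` is block-local.  This is the architecture of every quadratic family of the cell
(SHIFT-THREE through the port embedding, the DIAMOND / SQUARE / LADDER families: `G` = the `m` rotations, blocks = port groups),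
and of every block-diagonal design (`G = {1}`).  The design itself is ARBITRARY (not necessarily static).

THE LAW (`cosetSkeleton_law`).  For every dominance design of format `(m, K)` and every chain `q₀, …, qₙ` of terms dominant at
strictly increasing integer slopes with consecutive terms distinct and permutations in `G ∘ (block-local)`:

  `n + 1 ≤ |G| · (1 + Σ_j (multichoose K |B_j| − 1))`.

So the global factor contributes MULTIPLICATIVELY (`|G|`) and the local factor only ADDITIVELY (one counting term per block): with
blocks of bounded size the chain is `O(|G| · m)` — quadratic for `|G| = O(m)` (one rotation register), WHATEVER the classes and
valuations; a cubic `K = 4` family on such an architecture needs a two-parameter global factor `|G| = Ω(m²)` (cf. the balanced-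
skeleton law, which bounds 2-design-like `G`).
PROOF.  BLOCK EXCHANGE (`blockSlope_le`): two chain terms `X` (earlier) and `Y` (later) with the same `g` have the same row set on
every block, so «`Y` on block `j`, `X` elsewhere» and «`X` on block `j`, `Y` elsewhere» are present terms; dominance of `X` at `θ` and
of `Y` at `θ' > θ` against these hybrids adds up to `(θ' − θ)(s_j(Y) − s_j(X)) > 0` unless `X = Y` on block `j`.  Hence within one
`g`-class the block-slope vectors increase coordinatewise, strictly in total, so the rank potential `Σ_j #{w ∈ W_j : w < s_j}` is
injective on the class (`W_j` = the block-`j` slopes occurring), giving `|class| ≤ 1 + Σ_j (|W_j| − 1)`, and `|W_j| ≤ multichoose K |B_j|`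
(distinct slopes come from distinct class multisets).  [this cell; the exchange inequality is folklore]
-/

set_option linter.dupNamespace false
set_option autoImplicit false

namespace Summit.ValiantsHypothesis.ValiantsHypothesis.Theorems.KPlusLogSqLaw

namespace CosetSkeleton

open Summit.ValiantsHypothesis.ValiantsHypothesis.Theorems.MatrixDescartes.Negative
open Summit.ValiantsHypothesis.ValiantsHypothesis.Theorems.LacunarySymmetroidMatrixDescartes
open Summit.ValiantsHypothesis.ValiantsHypothesis.Theorems.LacunarySymmetroidMatrixDescartes.TropicalCensus
open Finset

variable {m K s : ℕ}

/-! ## 1. Block-local permutations and hybrids -/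

/-- restrict a block-local permutation `ρ` to the blocks NOT selected by the predicate `P` (identity on the selected blocks). [folklore] -/
def restrictOff (blk : Fin m → Fin s) (ρ : Equiv.Perm (Fin m)) (hρ : ∀ b, blk (ρ b) = blk b) (P : Fin s → Prop)
    [DecidablePred P] : Equiv.Perm (Fin m) where
  toFun b := if P (blk b) then b else ρ b
  invFun a := if P (blk a) then a else ρ.symm a
  left_inv b := by
    by_cases h : P (blk b)
    · simp [h]
    · have h' : ¬ P (blk (ρ b)) := by rw [hρ b]; exact h
      simp [h, h']
  right_inv a := by
    by_cases h : P (blk a)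
    · simp [h]
    · have h' : ¬ P (blk (ρ.symm a)) := by
        have := hρ (ρ.symm a)
        rw [Equiv.apply_symm_apply] at this
        rw [← this]; exact h
      simp [h, h']

/-- value of `restrictOff`. [folklore] -/
theorem restrictOff_apply (blk : Fin m → Fin s) (ρ : Equiv.Perm (Fin m)) (hρ : ∀ b, blk (ρ b) = blk b) (P : Fin s → Prop)
    [DecidablePred P] (b : Fin m) : restrictOff blk ρ hρ P b = if P (blk b) then b else ρ b := rfl

/-- **BLOCK EXCHANGE.**  `X = (σ, λ)` dominant at `θ`, `Y = (σ', λ')` dominant at `θ' > θ`, and `σ'⁻¹ ∘ σ` block-local (the two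
permutations have the same row set on every block).  Then on every block `j` the exponent mass of `Y` is at least that of `X`, with
equality only if the two terms agree on the block. [folklore: exchange against the two hybrids] -/
theorem blockSlope_le (d : Fin K → ℕ) (v ε : Fin m → Fin m → Fin K → ℤ) (blk : Fin m → Fin s) {θ θ' : ℤ} (hθ : θ < θ')
    (X Y : Equiv.Perm (Fin m) × (Fin m → Fin K)) (hX : IsDominant d v ε θ X) (hY : IsDominant d v ε θ' Y)
    (hloc : ∀ b, blk (Y.1.symm (X.1 b)) = blk b) (j : Fin s) :
    (∑ b ∈ univ.filter (fun b => blk b = j), (d (X.2 b) : ℤ)) ≤ ∑ b ∈ univ.filter (fun b => blk b = j), (d (Y.2 b) : ℤ) := by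
  classical
  set ρ : Equiv.Perm (Fin m) := X.1.trans Y.1.symm with hρdef
  have hρ : ∀ b, ρ b = Y.1.symm (X.1 b) := fun b => rfl
  have hρloc : ∀ b, blk (ρ b) = blk b := fun b => by rw [hρ]; exact hloc b
  -- hybrid H = «Y on block j, X elsewhere» = Y.1 ∘ restrictOff ρ (· = j); H' = «X on block j, Y elsewhere» = Y.1 ∘ restrictOff ρ (· ≠ j)
  set H : Equiv.Perm (Fin m) × (Fin m → Fin K) :=
    ((restrictOff blk ρ hρloc (fun i => i = j)).trans Y.1, fun b => if blk b = j then Y.2 b else X.2 b) with hH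
  set H' : Equiv.Perm (Fin m) × (Fin m → Fin K) :=
    ((restrictOff blk ρ hρloc (fun i => ¬ i = j)).trans Y.1, fun b => if blk b = j then X.2 b else Y.2 b) with hH'
  have hH1 : ∀ b, H.1 b = if blk b = j then Y.1 b else X.1 b := by
    intro b
    simp only [hH, Equiv.trans_apply, restrictOff_apply]
    split_ifs with h
    · rfl
    · rw [hρ, Equiv.apply_symm_apply]
  have hH'1 : ∀ b, H'.1 b = if blk b = j then X.1 b else Y.1 b := by
    intro b
    simp only [hH', Equiv.trans_apply, restrictOff_apply]
    split_ifs with h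
    · rw [hρ, Equiv.apply_symm_apply]
    · rfl
  -- presence of the hybrids
  have hXp := present_of_termSign_ne_zero ε X hX.1
  have hYp := present_of_termSign_ne_zero ε Y hY.1
  have hpresH : termSign ε H ≠ 0 := by
    unfold termSign
    refine mul_ne_zero (Units.ne_zero _) (Finset.prod_ne_zero_iff.mpr fun b _ => ?_)
    rw [hH1 b]
    simp only [hH]
    split_ifs with h
    · exact hYp b
    · exact hXp b
  have hpresH' : termSign ε H' ≠ 0 := by
    unfold termSign
    refine mul_ne_zero (Units.ne_zero _) (Finset.prod_ne_zero_iff.mpr fun b _ => ?_)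
    rw [hH'1 b]
    simp only [hH']
    split_ifs with h
    · exact hXp b
    · exact hYp b
  -- per-column scores
  set fX : Fin m → ℤ := fun b => θ * (d (X.2 b) : ℤ) - v (X.1 b) b (X.2 b) with hfX
  set fY : Fin m → ℤ := fun b => θ * (d (Y.2 b) : ℤ) - v (Y.1 b) b (Y.2 b) with hfY
  set gX : Fin m → ℤ := fun b => θ' * (d (X.2 b) : ℤ) - v (X.1 b) b (X.2 b) with hgX
  set gY : Fin m → ℤ := fun b => θ' * (d (Y.2 b) : ℤ) - v (Y.1 b) b (Y.2 b) with hgY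
  have wX : tropWeight d v θ X = ∑ b, fX b := RefreshExclusivity.tropWeight_eq_sum d v θ X
  have wY' : tropWeight d v θ' Y = ∑ b, gY b := RefreshExclusivity.tropWeight_eq_sum d v θ' Y
  have wH : tropWeight d v θ H = ∑ b, (if blk b = j then fY b else fX b) := by
    rw [RefreshExclusivity.tropWeight_eq_sum]
    refine Finset.sum_congr rfl fun b _ => ?_
    rw [hH1 b]; simp only [hH]
    split_ifs <;> rfl
  have wH' : tropWeight d v θ' H' = ∑ b, (if blk b = j then gX b else gY b) := by
    rw [RefreshExclusivity.tropWeight_eq_sum]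
    refine Finset.sum_congr rfl fun b _ => ?_
    rw [hH'1 b]; simp only [hH']
    split_ifs <;> rfl
  -- splitting sums into block `j` and the rest
  have split : ∀ f g : Fin m → ℤ, (∑ b, (if blk b = j then f b else g b)) - ∑ b, g b =
      ∑ b ∈ univ.filter (fun b => blk b = j), (f b - g b) := by
    intro f g
    rw [← Finset.sum_sub_distrib, ← Finset.sum_filter_add_sum_filter_not univ (fun b => blk b = j)]
    have h1 : ∑ b ∈ univ.filter (fun b => blk b = j), ((if blk b = j then f b else g b) - g b) =
        ∑ b ∈ univ.filter (fun b => blk b = j), (f b - g b) :=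
      Finset.sum_congr rfl fun b hb => by rw [if_pos (Finset.mem_filter.mp hb).2]
    have h2 : ∑ b ∈ univ.filter (fun b => ¬ blk b = j), ((if blk b = j then f b else g b) - g b) = 0 :=
      Finset.sum_eq_zero fun b hb => by rw [if_neg (Finset.mem_filter.mp hb).2, sub_self]
    rw [h1, h2, add_zero]
  -- case: the terms agree on block `j` — then equality
  by_cases hagree : ∀ b, blk b = j → X.1 b = Y.1 b ∧ X.2 b = Y.2 b
  · apply le_of_eq
    exact Finset.sum_congr rfl fun b hb => by rw [(hagree b (Finset.mem_filter.mp hb).2).2]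
  -- otherwise both hybrids are genuinely different terms
  have hHne : H ≠ X := by
    intro hHX
    apply hagree
    intro b hb
    have h1 : H.1 b = X.1 b := by rw [hHX]
    have h2 : H.2 b = X.2 b := by rw [hHX]
    rw [hH1 b, if_pos hb] at h1
    have h2' : Y.2 b = X.2 b := by simpa only [hH, if_pos hb] using h2
    exact ⟨h1.symm, h2'.symm⟩
  have hH'ne : H' ≠ Y := by
    intro hHY
    apply hagree
    intro b hb
    have h1 : H'.1 b = Y.1 b := by rw [hHY]
    have h2 : H'.2 b = Y.2 b := by rw [hHY]
    rw [hH'1 b, if_pos hb] at h1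
    have h2' : X.2 b = Y.2 b := by simpa only [hH', if_pos hb] using h2
    exact ⟨h1, h2'⟩
  have i1 := hX.2 H hHne hpresH      -- weight_θ H < weight_θ X
  have i2 := hY.2 H' hH'ne hpresH'   -- weight_θ' H' < weight_θ' Y
  rw [wH, wX] at i1
  rw [wH', wY'] at i2
  have j1 : ∑ b ∈ univ.filter (fun b => blk b = j), (fY b - fX b) < 0 := by rw [← split]; linarith
  have j2 : ∑ b ∈ univ.filter (fun b => blk b = j), (gX b - gY b) < 0 := by rw [← split]; linarith
  -- add: the valuations cancel, leaving `(θ' - θ)·(s_j(Y) - s_j(X)) > 0`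
  have key : (θ' - θ) * (∑ b ∈ univ.filter (fun b => blk b = j), ((d (Y.2 b) : ℤ) - d (X.2 b))) > 0 := by
    have e : (θ' - θ) * (∑ b ∈ univ.filter (fun b => blk b = j), ((d (Y.2 b) : ℤ) - d (X.2 b))) =
        -(∑ b ∈ univ.filter (fun b => blk b = j), (fY b - fX b)) -
          ∑ b ∈ univ.filter (fun b => blk b = j), (gX b - gY b) := by
      rw [Finset.mul_sum, ← Finset.sum_neg_distrib, ← Finset.sum_sub_distrib]
      refine Finset.sum_congr rfl fun b _ => ?_
      simp only [hfX, hfY, hgX, hgY]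
      ring
    rw [e]; linarith
  have hpos : 0 < ∑ b ∈ univ.filter (fun b => blk b = j), ((d (Y.2 b) : ℤ) - d (X.2 b)) := by
    by_contra hle
    push Not at hle
    have : (θ' - θ) * (∑ b ∈ univ.filter (fun b => blk b = j), ((d (Y.2 b) : ℤ) - d (X.2 b))) ≤ 0 :=
      mul_nonpos_of_nonneg_of_nonpos (by linarith) hle
    linarith
  rw [Finset.sum_sub_distrib] at hpos
  linarith

/-! ## 2. Counting inside one `g`-class, and the law -/

/-- the block slope of a term is the `d`-sum of its block class multiset, an element of `Sym (Fin K) |B_j|`. [folklore] -/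
theorem blockSlope_eq_of_sym (d : Fin K → ℕ) (B : Finset (Fin m)) (q : Equiv.Perm (Fin m) × (Fin m → Fin K)) :
    (∑ b ∈ B, (d (q.2 b) : ℤ)) =
      (((⟨B.val.map q.2, by simp⟩ : Sym (Fin K) B.card) : Multiset (Fin K)).map fun l => (d l : ℤ)).sum := by
  simp only [Multiset.map_map]
  rfl

/-- the number of distinct block slopes realised by any family of terms on a block `B` is at most `multichoose K |B|`. [folklore] -/
theorem card_blockSlopes_le (d : Fin K → ℕ) (B : Finset (Fin m)) {ι : Type*} (T : Finset ι)
    (q : ι → Equiv.Perm (Fin m) × (Fin m → Fin K)) :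
    (T.image fun i => ∑ b ∈ B, (d ((q i).2 b) : ℤ)).card ≤ Nat.multichoose K B.card := by
  classical
  have hsub : (T.image fun i => ∑ b ∈ B, (d ((q i).2 b) : ℤ)) ⊆
      (univ : Finset (Sym (Fin K) B.card)).image
        fun M : Sym (Fin K) B.card => ((M : Multiset (Fin K)).map fun l => (d l : ℤ)).sum := by
    intro x hx
    rw [Finset.mem_image] at hx ⊢
    obtain ⟨i, -, rfl⟩ := hx
    exact ⟨(⟨B.val.map (q i).2, by simp⟩ : Sym (Fin K) B.card), mem_univ _, (blockSlope_eq_of_sym d B (q i)).symm⟩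
  refine (Finset.card_le_card hsub).trans (Finset.card_image_le.trans ?_)
  rw [card_univ, Sym.card_sym_eq_multichoose, Fintype.card_fin]

/-- **RANK-POTENTIAL COUNT.**  A finite family `T` of index values carrying vectors `w i : Fin s → ℤ` that is a CHAIN for the
coordinatewise order with strictly increasing coordinate sum (for `i ≠ i'` in `T`, one of them is below the other in every
coordinate and strictly below in sum) has `|T| ≤ 1 + Σ_j (|W_j| − 1)`, `W_j` the set of `j`-th coordinates occurring. [folklore] -/
theorem card_chain_le {ι : Type*} [DecidableEq ι] (T : Finset ι) (w : ι → Fin s → ℤ)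
    (hchain : ∀ i ∈ T, ∀ i' ∈ T, i ≠ i' →
      ((∀ j, w i j ≤ w i' j) ∧ ∑ j, w i j < ∑ j, w i' j) ∨ ((∀ j, w i' j ≤ w i j) ∧ ∑ j, w i' j < ∑ j, w i j)) :
    T.card ≤ 1 + ∑ j, ((T.image fun i => w i j).card - 1) := by
  classical
  -- the rank potential
  set Φ : ι → ℕ := fun i => ∑ j, ((T.image fun i' => w i' j).filter fun x => x < w i j).card with hΦ
  -- Φ is bounded
  have hbound : ∀ i ∈ T, Φ i ≤ ∑ j, ((T.image fun i' => w i' j).card - 1) := by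
    intro i hi
    refine Finset.sum_le_sum fun j _ => ?_
    have hmem : w i j ∈ T.image fun i' => w i' j := Finset.mem_image.mpr ⟨i, hi, rfl⟩
    have hss : ((T.image fun i' => w i' j).filter fun x => x < w i j) ⊆ (T.image fun i' => w i' j).erase (w i j) := by
      intro x hx
      rw [Finset.mem_filter] at hx
      rw [Finset.mem_erase]
      exact ⟨ne_of_lt hx.2, hx.1⟩
    have := Finset.card_le_card hss
    rw [Finset.card_erase_of_mem hmem] at this
    exact this
  -- Φ is strictly monotone along the chain, hence injective on T
  have hlt : ∀ i ∈ T, ∀ i' ∈ T, (∀ j, w i j ≤ w i' j) → ∑ j, w i j < ∑ j, w i' j → Φ i < Φ i' := by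
    intro i hi i' hi' hle hsum
    obtain ⟨j₀, hj₀⟩ : ∃ j₀, w i j₀ < w i' j₀ := by
      by_contra hno
      push Not at hno
      have : ∑ j, w i' j ≤ ∑ j, w i j := Finset.sum_le_sum fun j _ => hno j
      linarith
    have hmono : ∀ j, ((T.image fun i'' => w i'' j).filter fun x => x < w i j).card ≤
        ((T.image fun i'' => w i'' j).filter fun x => x < w i' j).card := by
      intro j
      apply Finset.card_le_card
      intro x hx
      rw [Finset.mem_filter] at hx ⊢
      exact ⟨hx.1, lt_of_lt_of_le hx.2 (hle j)⟩
    have hstrict : ((T.image fun i'' => w i'' j₀).filter fun x => x < w i j₀).card <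
        ((T.image fun i'' => w i'' j₀).filter fun x => x < w i' j₀).card := by
      apply Finset.card_lt_card
      refine ⟨fun x hx => ?_, ?_⟩
      · rw [Finset.mem_filter] at hx ⊢
        exact ⟨hx.1, lt_of_lt_of_le hx.2 (hle j₀)⟩
      · rw [Finset.not_subset]
        refine ⟨w i j₀, ?_, ?_⟩
        · rw [Finset.mem_filter]
          exact ⟨Finset.mem_image.mpr ⟨i, hi, rfl⟩, hj₀⟩
        · rw [Finset.mem_filter]
          exact fun h => lt_irrefl _ h.2
    have hsumlt : (∑ j, ((T.image fun i'' => w i'' j).filter fun x => x < w i j).card) <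
        ∑ j, ((T.image fun i'' => w i'' j).filter fun x => x < w i' j).card :=
      Finset.sum_lt_sum (fun j _ => hmono j) ⟨j₀, mem_univ _, hstrict⟩
    simpa only [hΦ] using hsumlt
  have hinj : Set.InjOn Φ T := by
    intro i hi i' hi' e
    by_contra hne
    rcases hchain i hi i' hi' hne with ⟨hle, hsum⟩ | ⟨hle, hsum⟩
    · exact absurd e (ne_of_lt (hlt i hi i' hi' hle hsum))
    · exact absurd e.symm (ne_of_lt (hlt i' hi' i hi hle hsum))
  -- count: Φ maps T injectively into `range (bound + 1)`
  have hmaps : ∀ i ∈ T, Φ i ∈ Finset.range (1 + ∑ j, ((T.image fun i => w i j).card - 1)) := by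
    intro i hi
    rw [Finset.mem_range]
    have := hbound i hi
    omega
  have := Finset.card_le_card_of_injOn Φ hmaps hinj
  rwa [Finset.card_range] at this

/-- **THE COSET-SKELETON LAW.**  Any dominance design; a chain `q₀, …, qₙ` of terms dominant at strictly increasing integer slopes,
consecutive terms distinct; every permutation of the chain of the form `g ∘ τ` with `g ∈ G` and `τ` block-local for the column
blocks `blk` (stated as: `g⁻¹ ∘ σ_k` is block-local).  Then `n + 1 ≤ |G| · (1 + Σ_j (multichoose K |B_j| − 1))`. [this cell] -/
theorem cosetSkeleton_law (blk : Fin m → Fin s) (G : Finset (Equiv.Perm (Fin m)))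
    (d : Fin K → ℕ) (v ε : Fin m → Fin m → Fin K → ℤ)
    {n : ℕ} (θ : Fin (n + 1) → ℤ) (q : Fin (n + 1) → Equiv.Perm (Fin m) × (Fin m → Fin K))
    (hθ : StrictMono θ) (hdom : ∀ k, IsDominant d v ε (θ k) (q k))
    (hne : ∀ k : Fin n, q k.castSucc ≠ q k.succ)
    (hfac : ∀ k, ∃ g ∈ G, ∀ b, blk (g.symm ((q k).1 b)) = blk b) :
    n + 1 ≤ G.card * (1 + ∑ j : Fin s, (Nat.multichoose K (univ.filter fun b => blk b = j).card - 1)) := by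
  classical
  choose g hgG hg using hfac
  -- block slopes and their sum
  set w : Fin (n + 1) → Fin s → ℤ := fun k j => ∑ b ∈ univ.filter (fun b => blk b = j), (d ((q k).2 b) : ℤ) with hw
  have hsumw : ∀ k, ∑ j, w k j = TropicalCensus.slope d (q k) := by
    intro k
    simp only [hw]
    exact Finset.sum_fiberwise univ blk fun b => (d ((q k).2 b) : ℤ)
  have hsm : StrictMono fun k => TropicalCensus.slope d (q k) := by
    rw [Fin.strictMono_iff_lt_succ]
    intro k
    exact slope_lt_of_dominant d v ε (hθ Fin.castSucc_lt_succ) (hne k) (hdom _) (hdom _)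
  -- same `g` ⇒ block-local quotient ⇒ block slopes increase coordinatewise
  have hle : ∀ k k', k < k' → g k = g k' → ∀ j, w k j ≤ w k' j := by
    intro k k' hkk' hgg j
    have hloc : ∀ b, blk ((q k').1.symm ((q k).1 b)) = blk b := by
      intro b
      have h1 := hg k b
      have h2 := hg k' ((q k').1.symm ((q k).1 b))
      rw [Equiv.apply_symm_apply, ← hgg] at h2
      rw [← h2, h1]
    exact blockSlope_le d v ε blk (hθ hkk') (q k) (q k') (hdom k) (hdom k') hloc j
  -- count each class with the rank potential
  have hclass : ∀ g₀ ∈ G, (univ.filter fun k => g k = g₀).card ≤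
      1 + ∑ j : Fin s, (Nat.multichoose K (univ.filter fun b => blk b = j).card - 1) := by
    intro g₀ _
    set T := univ.filter fun k => g k = g₀ with hT
    have h1 := card_chain_le T w (by
      intro i hi i' hi' hii'
      rw [hT, Finset.mem_filter] at hi hi'
      have hgg : g i = g i' := by rw [hi.2, hi'.2]
      rcases lt_or_gt_of_ne hii' with h | h
      · left
        refine ⟨hle i i' h hgg, ?_⟩
        rw [hsumw, hsumw]; exact hsm h
      · right
        refine ⟨hle i' i h hgg.symm, ?_⟩
        rw [hsumw, hsumw]; exact hsm h)
    refine h1.trans ?_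
    have h2 : ∀ j : Fin s, (T.image fun i => w i j).card - 1 ≤
        Nat.multichoose K (univ.filter fun b => blk b = j).card - 1 := fun j =>
      Nat.sub_le_sub_right (card_blockSlopes_le d (univ.filter fun b => blk b = j) T q) 1
    have := Finset.sum_le_sum fun j (_ : j ∈ (univ : Finset (Fin s))) => h2 j
    omega
  -- sum over the classes
  have hpart := Finset.card_eq_sum_card_fiberwise (s := (univ : Finset (Fin (n + 1)))) (t := G) (f := g)
    (fun k _ => hgG k)
  rw [card_univ, Fintype.card_fin] at hpart
  rw [hpart]
  calc ∑ g₀ ∈ G, (univ.filter fun k => g k = g₀).card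
      ≤ ∑ g₀ ∈ G, (1 + ∑ j : Fin s, (Nat.multichoose K (univ.filter fun b => blk b = j).card - 1)) :=
        Finset.sum_le_sum hclass
    _ = G.card * (1 + ∑ j : Fin s, (Nat.multichoose K (univ.filter fun b => blk b = j).card - 1)) := by
        rw [Finset.sum_const, smul_eq_mul]

/-- the same for SIGN-ALTERNATING chains (the crux's hypotheses). [this cell] -/
theorem cosetSkeleton_law_signed (blk : Fin m → Fin s) (G : Finset (Equiv.Perm (Fin m)))
    (d : Fin K → ℕ) (v ε : Fin m → Fin m → Fin K → ℤ)
    {n : ℕ} (θ : Fin (n + 1) → ℤ) (q : Fin (n + 1) → Equiv.Perm (Fin m) × (Fin m → Fin K))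
    (hθ : StrictMono θ) (hdom : ∀ k, IsDominant d v ε (θ k) (q k))
    (halt : ∀ k : Fin n, termSign ε (q k.castSucc) * termSign ε (q k.succ) < 0)
    (hfac : ∀ k, ∃ g ∈ G, ∀ b, blk (g.symm ((q k).1 b)) = blk b) :
    n + 1 ≤ G.card * (1 + ∑ j : Fin s, (Nat.multichoose K (univ.filter fun b => blk b = j).card - 1)) := by
  refine cosetSkeleton_law blk G d v ε θ q hθ hdom (fun k h => ?_) hfac
  have := halt k
  rw [h] at this
  exact absurd this (not_lt.mpr (mul_self_nonneg _))

/-- **block-diagonal corollary** (`G = {1}`): a chain all of whose permutations are block-local has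
`n + 1 ≤ 1 + Σ_j (multichoose K |B_j| − 1)` — additivity of blocks in the permutation currency. [this cell] -/
theorem blockLocal_law (blk : Fin m → Fin s) (d : Fin K → ℕ) (v ε : Fin m → Fin m → Fin K → ℤ)
    {n : ℕ} (θ : Fin (n + 1) → ℤ) (q : Fin (n + 1) → Equiv.Perm (Fin m) × (Fin m → Fin K))
    (hθ : StrictMono θ) (hdom : ∀ k, IsDominant d v ε (θ k) (q k))
    (hne : ∀ k : Fin n, q k.castSucc ≠ q k.succ) (hloc : ∀ k b, blk ((q k).1 b) = blk b) :
    n + 1 ≤ 1 + ∑ j : Fin s, (Nat.multichoose K (univ.filter fun b => blk b = j).card - 1) := by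
  have h := cosetSkeleton_law blk {1} d v ε θ q hθ hdom hne (fun k => ⟨1, Finset.mem_singleton_self _, fun b => by
    rw [show (1 : Equiv.Perm (Fin m)).symm ((q k).1 b) = (q k).1 b from rfl]; exact hloc k b⟩)
  rwa [Finset.card_singleton, one_mul] at h

end CosetSkeleton

end Summit.ValiantsHypothesis.ValiantsHypothesis.Theorems.KPlusLogSqLaw
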